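import Literature.Probability.RandomPlanarGeometry.SLEBoundaryHittingProofs
import Literature.Probability.RandomPlanarGeometry.RohdeSchrammCor35Proofs
import Literature.Probability.RandomPlanarGeometry.SLETraceGeneralBM
import HarnessLib
import Literature.Probability.RandomPlanarGeometry.SLESixMoebiusImageDriver
import Literature.Probability.RandomPlanarGeometry.SLESixMoebiusPointFunctional
import Literature.Probability.RandomPlanarGeometry.LoewnerMoebiusTransport

/-!
# The stopped Möbius image of the SLE₆ trace is the stopped trace of the time-changed Brownian motion

Topic `Probability/RandomPlanarGeometry`; theorems only. The pathwise identification step of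
Lawler's Thm. 6.13 / Prop. 6.14 (G. F. Lawler (2005), §6.3) for the Möbius map `Φ_x`:
combining

* the stochastic side (`exists_isBrownianReal_timeChange` (`SLESixMoebiusImageDriver.lean`)): a Brownian
  motion `B̂` on the product space with `√6 B̂_{clk u} = drv_u` up to the localising time
  `ρ_n = locTime x n`;
* the deterministic Möbius transport (`LoewnerMoebiusTransport.lean`): the hulls, the
  trace and the real flow of `x` of the chain driven by `Û = √6 B̂` are the `Φ_x`-images of those
  of the chain of `W = √6 B`, in the capacity time `clk`;
* the intrinsic localisation (`pointLocTime_eq_of_dictionary` (`SLESixMoebiusPointFunctional.lean`)): the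
  intrinsic localising time of `x` under `Û` is `clk ρ_n`;

we prove (`ae_stoppedPathClass_eq_stoppedTraceClass`): for `W ⊗ W`-almost every `(ω, ω')`, the
class of `Φ_x ∘ γ|[0, ρ_n]` (`γ` the SLE₆ trace of `ω`) equals the measurable functional
`stoppedTraceClass x x² n` of `SLESixMoebiusPointFunctional.lean` evaluated on the path
`s ↦ √6 B̂_s(ω, ω')`. Auxiliary: the bridge `D = poleDeriv`, `drv = driver`, `clk = clock`
between the localised processes and the pathwise objects of `LoewnerMoebiusClock.lean`
(`MoebiusPole`), for the pole data `X r := X x n r⁺ ω`.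

## References

* G. F. Lawler, *Conformally Invariant Processes in the Plane*, AMS (2005), §6.3, Thm. 6.13,
  Prop. 6.14. [Lawler2005]
-/

noncomputable section

open MeasureTheory ProbabilityTheory Filter Set Function Complex
open UpperHalfPlane (upperHalfPlaneSet)
open scoped NNReal ENNReal Topology unitInterval

namespace Literature.Probability.RandomPlanarGeometry

namespace SLESixMoebius

open Loewner MoebiusPole MoebiusTransport Literature.Probability.Process
  Literature.Analysis.FunctionSpaces

variable {x : ℝ} {n : ℕ}

/-! ### The bridge to the pathwise pole data -/

section Bridge

variable (ω : ℝ≥0 → ℝ)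

/-- The pole data path `r ↦ X x n r⁺ ω` is continuous (`x ≠ 0`). [folklore] -/
theorem continuous_Xpath (hx : x ≠ 0) : Continuous fun r : ℝ ↦ X x n r.toNNReal ω :=
  (continuous_X hx ω).comp continuous_real_toNNReal

/-- The pole data path never vanishes. [folklore] -/
theorem Xpath_ne_zero (hx1 : 1 / level n < |x|) (hx2 : |x| < level n) (r : ℝ) :
    X x n r.toNNReal ω ≠ 0 := X_ne_zero hx1 hx2 _ ω

/-- **`D = poleDeriv`** along the pole data path, up to `ρ`. [folklore] -/
theorem D_eq_poleDeriv {u : ℝ} (hu0 : 0 ≤ u) (hu : ((u.toNNReal : ℝ≥0) : WithTop ℝ≥0) ≤ locTime x n ω) :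
    D x n u.toNNReal ω = poleDeriv (fun r : ℝ ↦ X x n r.toNNReal ω) u := by
  unfold D poleDeriv timeIntegral
  rw [Real.coe_toNNReal _ hu0]
  congr 2
  refine intervalIntegral.integral_congr fun r hr ↦ ?_
  rw [uIcc_of_le hu0] at hr
  have hrρ : (r.toNNReal : WithTop ℝ≥0) ≤ locTime x n ω :=
    (WithTop.coe_le_coe.2 (Real.toNNReal_le_toNNReal hr.2)).trans hu
  unfold dRate
  simp only [trunc_of_le hrρ]

/-- **`E = poleRatio`** along the pole data path, up to `ρ`. [folklore] -/
theorem E_eq_poleRatio {u : ℝ} (hu0 : 0 ≤ u) (hu : ((u.toNNReal : ℝ≥0) : WithTop ℝ≥0) ≤ locTime x n ω) :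
    E x n u.toNNReal ω = poleRatio (fun r : ℝ ↦ X x n r.toNNReal ω) u := by
  unfold E poleRatio timeIntegral
  rw [Real.coe_toNNReal _ hu0]
  refine intervalIntegral.integral_congr fun r hr ↦ ?_
  rw [uIcc_of_le hu0] at hr
  have hrρ : (r.toNNReal : WithTop ℝ≥0) ≤ locTime x n ω :=
    (WithTop.coe_le_coe.2 (Real.toNNReal_le_toNNReal hr.2)).trans hu
  unfold eRate
  simp only [trunc_of_le hrρ, D_eq_poleDeriv ω hr.1 hrρ]

/-- **`drv = driver`** along the pole data path, up to `ρ`. [folklore] -/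
theorem drv_eq_driver {u : ℝ} (hu0 : 0 ≤ u) (hu : ((u.toNNReal : ℝ≥0) : WithTop ℝ≥0) ≤ locTime x n ω) :
    drv x n u.toNNReal ω = driver x (x ^ 2) (fun r : ℝ ↦ X x n r.toNNReal ω) u := by
  unfold drv farPt driver farPoint
  rw [E_eq_poleRatio ω hu0 hu, D_eq_poleDeriv ω hu0 hu]

/-- **`clk = clock`** along the pole data path, up to `ρ`. [folklore] -/
theorem clk_eq_clock {u : ℝ} (hu0 : 0 ≤ u) (hu : ((u.toNNReal : ℝ≥0) : WithTop ℝ≥0) ≤ locTime x n ω) :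
    clk x n u.toNNReal ω = clock (x ^ 2) (fun r : ℝ ↦ X x n r.toNNReal ω) u := by
  unfold clk clock timeIntegral rate
  rw [Real.coe_toNNReal _ hu0]
  refine intervalIntegral.integral_congr fun r hr ↦ ?_
  rw [uIcc_of_le hu0] at hr
  have hrρ : (r.toNNReal : WithTop ℝ≥0) ≤ locTime x n ω :=
    (WithTop.coe_le_coe.2 (Real.toNNReal_le_toNNReal hr.2)).trans hu
  unfold clkRate
  simp only [trunc_of_le hrρ, D_eq_poleDeriv ω hr.1 hrρ]

/-- The pole data path is the frozen real flow of the pole on `[0, ρ]`. [folklore] -/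
theorem Xpath_eq_realFlowStop {ρf : ℝ≥0} (hρ : (ρf : WithTop ℝ≥0) = locTime x n ω) {u : ℝ}
    (hu : u ∈ Icc 0 (ρf : ℝ)) :
    X x n u.toNNReal ω = realFlowStop (sleDriving 6 ω) (-x) u.toNNReal := by
  have huρ : (u.toNNReal : WithTop ℝ≥0) ≤ locTime x n ω := by
    rw [← hρ]; exact WithTop.coe_le_coe.2 (Real.toNNReal_le_iff_le_coe.2 hu.2)
  rw [X_eq_gap_of_le huρ]; rfl

/-- The localising time is positive. [folklore] -/
theorem locTime_pos (hx1 : 1 / level n < |x|) (hx2 : |x| < level n) : 0 < locTime x n ω := by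
  have hx := ne_zero_of_inv_level_lt hx1
  have h1 : 0 < gapExit x n ω := by
    refine Process.exitTime_pos (continuous_gap hx ω) ?_
    rw [gap_zero hx]; exact neg_mem_Ioo_band hx1 hx2
  have h2 : 0 < Process.exitTime (ratioPre x n) (1 / level n) (level n) ω := by
    refine Process.exitTime_pos (continuous_ratioPre hx1 hx2 ω) ?_
    rw [ratioPre_zero hx]; exact ⟨hx1, hx2⟩
  have h3 : (0 : WithTop ℝ≥0) < (((n : ℝ≥0) + 1 : ℝ≥0) : WithTop ℝ≥0) :=
    WithTop.coe_pos.2 (by positivity)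
  exact lt_min h1 (lt_min h2 h3)

end Bridge

/-! ### The pathwise identification -/

/-- **Pathwise identification.** Fix `1/N < |x| < N`, a sample `ω` whose SLE₆ chain is generated
by its trace `γ`, and a continuous path `Û` whose chain is generated by a curve, such that
`Û(clk u) = drv u` for `u ≤ ρ_n(ω)`. Then the class of `Φ_x ∘ γ|[0, ρ_n]` is
`stoppedTraceClass x x² n Û` (Möbius transport of hulls, trace and real flow in the capacity
clock; intrinsic localisation; reparametrisation by the clock). [cite: Lawler2005, §6.3 Thm. 6.13] -/
theorem stoppedPathClass_eq_stoppedTraceClass (hx1 : 1 / level n < |x|) (hx2 : |x| < level n)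
    {ω : ℝ≥0 → ℝ} (hgen : IsGeneratedByCurve (sleDriving 6 ω) (sleTrace 6 ω))
    {Û : ℝ≥0 → ℝ} (hÛ : Continuous Û) (hgen' : ∃ γ', IsGeneratedByCurve Û γ')
    (hagree : ∀ u : ℝ≥0, (u : WithTop ℝ≥0) ≤ locTime x n ω →
      Û (clk x n u ω).toNNReal = drv x n u ω) :
    stoppedPathClass (retargetMoebius x) (sleTrace 6 ω) ((locTime x n ω).untopD 0) =
      stoppedTraceClass x (x ^ 2) n Û := by
  have hx := ne_zero_of_inv_level_lt hx1
  have hb : (x ^ 2 : ℝ) ≠ 0 := pow_ne_zero 2 hx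
  set W := sleDriving 6 ω with hWdef
  have hW : Continuous W := continuous_sleDriving 6 ω
  have hW0 : W 0 = 0 := sleDriving_zero 6 ω
  set γ := sleTrace 6 ω with hγdef
  obtain ⟨γ', hγ'⟩ := hgen'
  have htr' : trace Û = γ' := IsGeneratedByCurve.trace_eq_holds hÛ hγ'
  -- the finite localising time and the pole data path
  obtain ⟨ρf, hρ⟩ := WithTop.ne_top_iff_exists.1 (locTime_ne_top (x := x) (n := n) ω)
  rw [← hρ, WithTop.untopD_coe]
  set Xp : ℝ → ℝ := fun r ↦ X x n r.toNNReal ω with hXp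
  have hXc : Continuous Xp := continuous_Xpath ω hx
  have hX0 : ∀ r, Xp r ≠ 0 := Xpath_ne_zero ω hx1 hx2
  have hu₁ : (ρf : WithTop ℝ≥0) < swallowingTime W ((-x : ℝ) : ℂ) := by
    rw [hρ]; exact locTime_lt_swallowingTime hx1 hx2 ω
  have hXW : ∀ u : ℝ, u ∈ Icc 0 (ρf : ℝ) → Xp u = realFlowStop W (-x) u.toNNReal :=
    fun u hu ↦ Xpath_eq_realFlowStop ω hρ hu
  have hρpos : 0 < ρf := by
    have := locTime_pos ω hx1 hx2; rwa [← hρ, WithTop.coe_pos] at this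
  have hρ0 : (0 : ℝ) ≤ ρf := ρf.coe_nonneg
  -- the agreement in the form consumed by the transport
  have hmemρ : ∀ {u : ℝ}, u ∈ Icc 0 (ρf : ℝ) → ((u.toNNReal : ℝ≥0) : WithTop ℝ≥0) ≤ locTime x n ω :=
    fun hu ↦ by rw [← hρ]; exact WithTop.coe_le_coe.2 (Real.toNNReal_le_iff_le_coe.2 hu.2)
  have hÛeq : ∀ r : ℝ, r ∈ Icc 0 (clock (x ^ 2) Xp ρf) →
      Û r.toNNReal = driver x (x ^ 2) Xp (invClock (x ^ 2) Xp ρf r) := by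
    intro r hr
    set u := invClock (x ^ 2) Xp ρf r with hu
    have humem : u ∈ Icc (0 : ℝ) ρf := invClock_mem_Icc hXc hX0 hb hρ0 hr
    have hcu : clock (x ^ 2) Xp u = r := clock_invClock_of_mem hXc hX0 hb hρ0
      (Ioo_subset_Icc_self (Icc_subset_Ioo_clock hXc hX0 hb hr))
    have h := hagree u.toNNReal (hmemρ humem)
    rw [clk_eq_clock ω humem.1 (hmemρ humem), drv_eq_driver ω humem.1 (hmemρ humem)] at h
    change Û (clock (x ^ 2) Xp u).toNNReal = driver x (x ^ 2) Xp u at h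
    rwa [hcu] at h
  have hÛ0 : Û 0 = 0 := by
    have h := hagree 0 bot_le
    rwa [clk_zero, Real.toNNReal_zero, drv_zero hx] at h
  -- the capacity horizon `Ŝ = clock ρf > 0`
  set S : ℝ := clock (x ^ 2) Xp ρf with hSdef
  have hSpos : 0 < S := by
    have := strictMono_clock hXc hX0 hb (b := x ^ 2) (show (0 : ℝ) < ρf from hρpos)
    rwa [clock_zero] at this
  set Ŝ : ℝ≥0 := S.toNNReal with hŜ
  have hŜcoe : (Ŝ : ℝ) = S := Real.coe_toNNReal _ hSpos.le
  -- the inverse clock as a map of times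
  set υ : ℝ≥0 → ℝ≥0 := fun s ↦ (invClock (x ^ 2) Xp ρf s).toNNReal with hυ
  have hυmem : ∀ s : ℝ≥0, (s : ℝ) ≤ S → invClock (x ^ 2) Xp ρf s ∈ Icc (0 : ℝ) ρf := fun s hs ↦
    invClock_mem_Icc hXc hX0 hb hρ0 ⟨s.coe_nonneg, hs⟩
  have hυcoe : ∀ s : ℝ≥0, (s : ℝ) ≤ S → ((υ s : ℝ≥0) : ℝ) = invClock (x ^ 2) Xp ρf s := fun s hs ↦
    Real.coe_toNNReal _ (hυmem s hs).1
  have hυS : υ Ŝ = ρf := by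
    apply NNReal.eq
    rw [hυcoe Ŝ (le_of_eq hŜcoe), hŜcoe, hSdef, invClock_clock hXc hX0 hb hρ0 ⟨by linarith, by linarith⟩]
  have hυlt : ∀ s : ℝ≥0, s < Ŝ → υ s < ρf := by
    intro s hs
    have hs' : (s : ℝ) < S := by rw [← hŜcoe]; exact_mod_cast hs
    rw [← NNReal.coe_lt_coe, hυcoe s hs'.le]
    exact invClock_lt hXc hX0 hb hρ0 s.coe_nonneg hs'
  have hυle : ∀ s : ℝ≥0, (s : ℝ) ≤ S → (υ s : WithTop ℝ≥0) ≤ locTime x n ω := fun s hs ↦ by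
    have := hmemρ (hυmem s hs); rwa [hυ]
  -- the dictionary: the real flow of `x` under `Û`
  have hflow : ∀ s : ℝ≥0, (s : ℝ) ≤ S →
      pointGap x s Û = -(x ^ 2 * D x n (υ s) ω / X x n (υ s) ω) := by
    intro s hs
    have h := (realFlowStop_image_far hx hXc hX0 hÛ hÛeq hSpos hs).2
    unfold pointGap
    rw [regPath_eq_self hÛ hÛ0, h]
    simp only [hυ]
    rw [D_eq_poleDeriv ω (hυmem s hs).1 (hmemρ (hυmem s hs))]
  -- the integrands of the two quadrature identities, read through the dictionary
  -- `D = poleDeriv` at the inverse-clock times, real-indexed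
  have hDr : ∀ r ∈ Icc (0 : ℝ) S, D x n (invClock (x ^ 2) Xp ρf r).toNNReal ω =
      poleDeriv Xp (invClock (x ^ 2) Xp ρf r) := by
    intro r hr
    have hu := invClock_mem_Icc hXc hX0 hb hρ0 hr
    exact D_eq_poleDeriv ω hu.1 (hmemρ hu)
  have hintegrand : ∀ s : ℝ≥0, (s : ℝ) ≤ S → ∀ r ∈ Icc (0 : ℝ) s,
      pointGap x r.toNNReal Û = -(x ^ 2 * poleDeriv Xp (invClock (x ^ 2) Xp ρf r) /
        Xp (invClock (x ^ 2) Xp ρf r)) := by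
    intro s hs r hr
    have hr' : ((r.toNNReal : ℝ≥0) : ℝ) ≤ S := by rw [Real.coe_toNNReal _ hr.1]; exact hr.2.trans hs
    rw [hflow r.toNNReal hr']
    simp only [hυ, Real.coe_toNNReal _ hr.1]
    rw [hDr r ⟨hr.1, hr.2.trans hs⟩]
  have hderiv : ∀ s : ℝ≥0, (s : ℝ) ≤ S →
      Real.exp (-∫ r in (0 : ℝ)..s, 2 / pointGap x r.toNNReal Û ^ 2) = D x n (υ s) ω := by
    intro s hs
    have hu := hυmem s hs
    have hcu : clock (x ^ 2) Xp (invClock (x ^ 2) Xp ρf s) = s := clock_invClock_of_mem hXc hX0 hb hρ0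
      (Ioo_subset_Icc_self (Icc_subset_Ioo_clock hXc hX0 hb ⟨s.coe_nonneg, hs⟩))
    have h := exp_neg_integral_imageGap hXc hX0 hb hρ0 hu
    rw [hcu] at h
    simp only [hυ]
    rw [hDr s ⟨s.coe_nonneg, hs⟩, ← h]
    congr 2
    refine intervalIntegral.integral_congr fun r hr ↦ ?_
    rw [uIcc_of_le s.coe_nonneg] at hr
    rw [hintegrand s hs r hr]
  have htime : ∀ s : ℝ≥0, (s : ℝ) ≤ S → ∫ r in (0 : ℝ)..s, (x ^ 2 *
      Real.exp (-∫ r' in (0 : ℝ)..r, 2 / pointGap x r'.toNNReal Û ^ 2) /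
        pointGap x r.toNNReal Û ^ 2) ^ 2 = υ s := by
    intro s hs
    have hu := hυmem s hs
    have hcu : clock (x ^ 2) Xp (invClock (x ^ 2) Xp ρf s) = s := clock_invClock_of_mem hXc hX0 hb hρ0
      (Ioo_subset_Icc_self (Icc_subset_Ioo_clock hXc hX0 hb ⟨s.coe_nonneg, hs⟩))
    have h := integral_imageRate_eq hXc hX0 hb hρ0 hu
    rw [hcu] at h
    rw [hυcoe s hs, ← h]
    refine intervalIntegral.integral_congr fun r hr ↦ ?_
    rw [uIcc_of_le s.coe_nonneg] at hr
    have hr' : ((r.toNNReal : ℝ≥0) : ℝ) ≤ S := by rw [Real.coe_toNNReal _ hr.1]; exact hr.2.trans hs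
    have hd := hderiv r.toNNReal hr'
    simp only [Real.coe_toNNReal _ hr.1] at hd
    simp only [hd, hυ, Real.coe_toNNReal _ hr.1, hintegrand s hs r hr]
    rw [hDr r ⟨hr.1, hr.2.trans hs⟩]
  -- the intrinsic localising time of `Û` is `Ŝ`
  have hmatch : pointLocTime x (x ^ 2) n Û = Ŝ :=
    pointLocTime_eq_of_dictionary hx1 hx2 hρ hυS hυlt
      (fun s hs ↦ hflow s (by rw [← hŜcoe]; exact_mod_cast hs))
      (fun s hs ↦ hderiv s (by rw [← hŜcoe]; exact_mod_cast hs))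
      (fun s hs ↦ htime s (by rw [← hŜcoe]; exact_mod_cast hs))
  -- the trace transport: `γ'(clock t) = Φ_x(γ t)` for `t ∈ (0, ρf]`
  have hTswallow : swallowingTime W ((-x : ℝ) : ℂ) = firstHit γ (realRay (-x)) :=
    swallowingTime_ofReal_eq_firstHit_of_ne hW hW0 hgen (neg_ne_zero.2 hx)
  have hγp : ∀ t : ℝ≥0, t ≤ ρf → γ t ≠ -x := by
    intro t ht hγt
    have hlt : (t : WithTop ℝ≥0) < firstHit γ (realRay (-x)) := by
      rw [← hTswallow]; exact (WithTop.coe_le_coe.2 ht).trans_lt hu₁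
    have hmem : γ t ∈ realRay (-x) := by
      rw [hγt]; exact_mod_cast ofReal_mem_realRay (-x)
    exact notMem_of_lt_firstHit hlt hmem
  have htrace : ∀ t : ℝ≥0, 0 < t → t ≤ ρf →
      γ' (clock (x ^ 2) Xp t).toNNReal = retargetMoebius x (γ t) := fun t ht0 ht ↦
    trace_image_eq hW hx hXc hX0 hu₁ hXW hÛ hÛeq hgen hγ' ht0 ht (hγp t ht)
  have htrace0 : γ' 0 = retargetMoebius x (γ 0) := by
    rw [hγ'.apply_zero, hÛ0, hgen.apply_zero, hW0]
    push_cast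
    rw [retargetMoebius.map_zero]
  -- continuity of `Φ_x ∘ γ` on the stopped range
  have hinner : Continuous fun s : I ↦ γ (((ρf : ℝ) * s).toNNReal) :=
    hgen.continuous.comp (continuous_real_toNNReal.comp (continuous_const.mul continuous_subtype_val))
  have hcontΦγ : Continuous (fun s : I ↦ retargetMoebius x (γ (((ρf : ℝ) * s).toNNReal))) := by
    refine continuous_iff_continuousAt.2 fun s ↦ ?_
    have hmem : (((ρf : ℝ) * s).toNNReal) ≤ ρf := by
      rw [← NNReal.coe_le_coe, Real.coe_toNNReal _ (mul_nonneg hρ0 s.2.1)]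
      exact mul_le_of_le_one_right hρ0 s.2.2
    exact ContinuousAt.comp (f := fun s : I ↦ γ (((ρf : ℝ) * s).toNNReal))
      (retargetMoebius.continuousAt (hγp _ hmem)) hinner.continuousAt
  -- both sides as classes of explicit curves
  rw [stoppedTraceClass_eq_of_continuous hÛ hÛ0 (by rw [htr']; exact hγ'.continuous), hmatch,
    WithTop.untopD_coe, stoppedPathClass_eq hcontΦγ]
  have hγ'c : Continuous (trace Û) := by rw [htr']; exact hγ'.continuous
  rw [show stoppedPathClass id (trace Û) Ŝ = stoppedClass ⟨trace Û, hγ'c⟩ Ŝ from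
    stoppedPathClass_id_eq_stoppedClass ⟨trace Û, hγ'c⟩ Ŝ]
  -- reparametrise by the clock
  refine mk_eq_stoppedClass_of_monotone ⟨trace Û, hγ'c⟩ Ŝ (φ := fun r ↦ clock (x ^ 2) Xp (ρf * r))
    ((continuous_clock hXc hX0).comp (continuous_const.mul continuous_id))
    (((strictMono_clock hXc hX0 hb (b := x ^ 2)).monotone).comp
      fun a b hab ↦ mul_le_mul_of_nonneg_left hab hρ0) (by simp [clock_zero])
    (by rw [mul_one, hŜcoe]) fun s ↦ ?_
  -- pointwise: `Φ_x(γ(ρf s)) = γ'(clock(ρf s))`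
  show retargetMoebius x (γ (((ρf : ℝ) * s).toNNReal)) =
    trace Û (clock (x ^ 2) Xp (ρf * s)).toNNReal
  rw [htr']
  rcases (mul_nonneg hρ0 s.2.1).eq_or_lt with h0 | hpos
  · rw [← h0, Real.toNNReal_zero, clock_zero, Real.toNNReal_zero, htrace0]
  · have hmem : (((ρf : ℝ) * s).toNNReal) ≤ ρf := by
      rw [← NNReal.coe_le_coe, Real.coe_toNNReal _ hpos.le]
      exact mul_le_of_le_one_right hρ0 s.2.2
    have h := htrace _ (Real.toNNReal_pos.2 hpos) hmem
    rw [Real.coe_toNNReal _ hpos.le] at h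
    exact h.symm

/-! ### The almost sure identification on the product space -/

/-- **Almost sure identification.** For `1/N < |x| < N` there is a real Brownian motion `B̂` on
`((ℝ≥0 → ℝ)², W ⊗ W)` with measurable marginals and continuous paths such that, for
`W ⊗ W`-a.e. `(ω, ω')`, the class of the Möbius image `Φ_x ∘ γ|[0, ρ_n]` of the SLE₆ trace of
`ω` stopped at the localising time equals the measurable stopped-trace functional
`stoppedTraceClass x x² n` of the path `s ↦ √6 B̂_s(ω, ω')` (whose Loewner chain is, almost
surely, generated by a curve: Rohde–Schramm for a general Brownian motion).
[cite: Lawler2005, §6.3 Thm. 6.13] -/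
theorem ae_stoppedPathClass_eq_stoppedTraceClass (hx1 : 1 / level n < |x|) (hx2 : |x| < level n) :
    ∃ B : ℝ≥0 → (ℝ≥0 → ℝ) × (ℝ≥0 → ℝ) → ℝ,
      IsBrownianReal B (preWienerMeasure.prod preWienerMeasure) ∧ (∀ t, Measurable (B t)) ∧
      (∀ p, Continuous (B · p)) ∧
      ∀ᵐ p ∂(preWienerMeasure.prod preWienerMeasure),
        stoppedPathClass (retargetMoebius x) (sleTrace 6 p.1) ((locTime x n p.1).untopD 0) =
          stoppedTraceClass x (x ^ 2) n (fun s ↦ Real.sqrt 6 * B s p) := by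
  haveI := isProbabilityMeasure_preWienerMeasure'
  obtain ⟨B, hB, hBm, hBc, hagree⟩ := exists_isBrownianReal_timeChange hx1 hx2
  refine ⟨B, hB, hBm, hBc, ?_⟩
  -- a.s. the SLE₆ chain of `ω` is generated by its trace
  have hgen : ∀ᵐ ω ∂preWienerMeasure, IsGeneratedByCurve (sleDriving 6 ω) (sleTrace 6 ω) := by
    filter_upwards [hasSLETrace_of_ne_eight_apply (κ := 6) (by norm_num)] with ω hω
    exact isGeneratedByCurve_trace hω
  have hgen₁ : ∀ᵐ p ∂(preWienerMeasure.prod preWienerMeasure),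
      IsGeneratedByCurve (sleDriving 6 p.1) (sleTrace 6 p.1) := by
    have h : (preWienerMeasure.prod preWienerMeasure).map Prod.fst = preWienerMeasure := by
      rw [Measure.map_fst_prod, measure_univ, one_smul]
    have h' : ∀ᵐ ω ∂(preWienerMeasure.prod preWienerMeasure).map Prod.fst,
        IsGeneratedByCurve (sleDriving 6 ω) (sleTrace 6 ω) := by rw [h]; exact hgen
    exact ae_of_ae_map measurable_fst.aemeasurable h'
  -- a.s. the chain of `√6 B̂` is generated by a curve
  have hgen₂ := ae_isGeneratedByCurve_of_isBrownianReal hB hBc (κ := 6) (by norm_num) (by norm_num)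
  filter_upwards [hgen₁, hgen₂] with p hp₁ hp₂
  have hÛc : Continuous fun s ↦ Real.sqrt 6 * B s p := continuous_const.mul (hBc p)
  have hsqrt : Real.sqrt ((6 : ℝ≥0) : ℝ) = Real.sqrt 6 := by norm_num
  have hp₂' : ∃ γ', IsGeneratedByCurve (fun s ↦ Real.sqrt 6 * B s p) γ' := by
    simpa only [hsqrt] using hp₂
  exact stoppedPathClass_eq_stoppedTraceClass hx1 hx2 hp₁ hÛc hp₂' (fun u hu ↦ hagree p u hu)

end SLESixMoebius

end Literature.Probability.RandomPlanarGeometry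

end
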